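import Summits.CriticalPhenomena.PercolationContinuityZ3.Theorems.PercNearOneGluingNoHeavyLowerTailUpsetExchange
import Summits.CriticalPhenomena.PercolationContinuityZ3.Theorems.PercNearOneGluingAdditiveGluingGluingLemma5
import HarnessLib

/-!
# `NoHeavyLowerTail` (stmt-CriticalPhenomena-4575) — up-set exchange with an ARBITRARY ranking graph on the block

Support file (hull-port / coupling seat `prim-hp-1` gen 7; `--supports stmt-CriticalPhenomena-4575`).
No definitions, no named facts, no sorries.

`UpsetExchange.upsetExchange` (this seat, p192722) asks the weights to vanish on the pairs inside the block `S`.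
Here that hypothesis is dropped: the comparison `μ_w(a ↔ b) ≤ μ_w(v ↔ b)` may be taken in ANY graph `w`, whatever
its weights inside `S` — the conclusion lives in `glue_S w`, which does not see them.  Consequently, for a fixed
glued block, EVERY weighting of the internal pairs is an admissible "ranking graph" for the anchor `v`
(split hubs: weight `0`; Kozma–Nitzan's hub-edges `c ∈ (0,1]`; the glued block itself: weight `1`) — the
'admissible gadget' freedom of memo HULLPORT-COUPLING.md §48 ((★★): 0 violations on random gadgets).

* `upsetExchange_any` — `v ∉ S`, `s₀ ∈ S`, `C` a finite set of non-loop pairs meeting `S` with `s(s₀,v) ∈ C`,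
  `μ_w(a ↔ b) ≤ μ_w(v ↔ b)`  ⟹  `μ_{glue_S w}(a ↔ b, C open) ≤ μ_{glue_S w}(v ↔ b, C open)`;
  `upsetExchange_any_block` — `… ≤ μ_{glue_S w}(s₀ ↔ b, C open)`.
  Proof: the sprinkling of `stub_gluingLemma5` (weights `(1−ε)w + ε` inside `S`), KN Lemma 3(i) (`knLemma3i`) for
  the event `{D ∪ C open}` (increasing in the open edge cluster of `v`), conditioning on `{D open}` = gluing
  (`gluingLemma5_real_inter_allOpen`), continuity in the weights (`stub_weightContinuity`), `ε → 0`.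
-/

namespace Summit.CriticalPhenomena.PercolationContinuityZ3.Theorems

open MeasureTheory Set ProbabilityTheory Filter Topology
open Literature.Probability.LatticeModels
open Literature.Probability.Percolation

noncomputable section
open Classical

namespace UpsetExchange

variable {n : ℕ}

/-- **Up-set exchange, any internal weights.**  See the module docstring.
[cite: KozmaNitzan2024, Lemma 5 and Lemma 3(i) (pp. 6, 13); VandenbergHaggstromKahn2005, Thm. 1.2] -/
theorem upsetExchange_any (w : Sym2 (Fin n) → unitInterval) (S : Finset (Fin n)) (a b v s₀ : Fin n)
    (hvS : v ∉ S) (hs₀ : s₀ ∈ S)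
    (C : Finset (Sym2 (Fin n))) (hC : ∀ e ∈ C, ¬ e.IsDiag ∧ ∃ x ∈ e, x ∈ S) (hsv : s(s₀, v) ∈ C)
    (hyp : (prodBernoulli w).real (openConn a b) ≤ (prodBernoulli w).real (openConn v b)) :
    (prodBernoulli (fun e : Sym2 (Fin n) => if (∀ x ∈ e, x ∈ S) ∧ ¬ e.IsDiag then 1 else w e)).real
        (openConn a b ∩ {ω | (↑C : Set (Sym2 (Fin n))) ⊆ ω}) ≤
      (prodBernoulli (fun e : Sym2 (Fin n) => if (∀ x ∈ e, x ∈ S) ∧ ¬ e.IsDiag then 1 else w e)).real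
        (openConn v b ∩ {ω | (↑C : Set (Sym2 (Fin n))) ⊆ ω}) := by
  classical
  set g : Sym2 (Fin n) → unitInterval := fun e => if (∀ x ∈ e, x ∈ S) ∧ ¬ e.IsDiag then 1 else w e with hg
  set D : Finset (Sym2 (Fin n)) := Finset.univ.filter (fun e => (∀ x ∈ e, x ∈ S) ∧ ¬ e.IsDiag) with hDdef
  have hD : ∀ e, e ∈ D ↔ (∀ x ∈ e, x ∈ S) ∧ ¬ e.IsDiag := fun e => by simp [hDdef]
  set ED : Set (BondConfig (Fin n)) := {ω | (↑D : Set (Sym2 (Fin n))) ⊆ ω} with hEDdef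
  set EC : Set (BondConfig (Fin n)) := {ω | (↑C : Set (Sym2 (Fin n))) ⊆ ω} with hECdef
  set Q : Set (BondConfig (Fin n)) := EC ∩ ED with hQdef
  have hvs₀ : v ≠ s₀ := fun h => hvS (h ▸ hs₀)
  -- `Q = {C ∪ D open}` is increasing in the open edge cluster of `v`
  have hQmono : ∀ ω ω', ω ∈ Q → openEdgeCluster ω v ⊆ openEdgeCluster ω' v → ω' ∈ Q := by
    intro ω ω' hω hsub
    have key := subset_openEdgeCluster_of_open S C v s₀ hs₀ hsv hvs₀ hC ω
      (fun e heS hed => hω.2 (Finset.mem_coe.2 ((hD e).2 ⟨heS, hed⟩))) hω.1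
    refine ⟨fun e he => openEdgeCluster_subset ω' v (hsub (key.2 he)), fun e he => ?_⟩
    have he' := (hD e).1 (Finset.mem_coe.1 he)
    exact openEdgeCluster_subset ω' v (hsub (key.1 e he'.1 he'.2))
  -- the sprinkled weights
  set u : unitInterval → Sym2 (Fin n) → unitInterval :=
    fun ε e => if e ∈ D then Set.Icc.convexComb (w e) 1 ε else w e with hu
  have hwu : ∀ ε, w ≤ u ε := by
    intro ε e
    by_cases he : e ∈ D
    · simp only [hu, he, if_true]
      exact Set.Icc.le_convexComb unitInterval.le_one' ε
    · simp only [hu, he, if_false]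
      exact le_rfl
  have hu0 : u 0 = w := by
    funext e
    by_cases he : e ∈ D
    · simp only [hu, he, if_true, Set.Icc.convexComb_zero]
    · simp only [hu, he, if_false]
  have hucont : Continuous u := by
    refine continuous_pi fun e => ?_
    by_cases he : e ∈ D
    · simp only [hu, he, if_true]
      exact Set.Icc.continuous_convexComb (w e) 1
    · simp only [hu, he, if_false]
      exact continuous_const
  have hpin : ∀ ε, (fun e => if e ∈ D then (1 : unitInterval) else u ε e) = g := by
    intro ε
    funext e
    by_cases he : e ∈ D
    · simp only [hg, he, if_true, if_pos ((hD e).1 he)]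
    · have he' : ¬ ((∀ x ∈ e, x ∈ S) ∧ ¬ e.IsDiag) := fun h => he ((hD e).2 h)
      simp only [hg, hu, he, if_false, if_neg he']
  -- conditioning on `ED` is gluing (for any event, in particular `X ∩ EC`)
  have hcond : ∀ ε (X : Set (BondConfig (Fin n))),
      (prodBernoulli (u ε)).real (X ∩ Q) = (prodBernoulli (u ε)).real ED * (prodBernoulli g).real (X ∩ EC) := by
    intro ε X
    rw [hQdef, ← inter_assoc, hEDdef, gluingLemma5_real_inter_allOpen (u ε) D MeasurableSet.of_discrete, hpin ε]
  have hcondQ : ∀ ε, (prodBernoulli (u ε)).real Q = (prodBernoulli (u ε)).real ED * (prodBernoulli g).real EC := by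
    intro ε
    have := hcond ε univ
    rwa [univ_inter, univ_inter] at this
  have hpos : ∀ ε : unitInterval, 0 < (ε : ℝ) → 0 < (prodBernoulli (u ε)).real ED := by
    intro ε hε
    rw [hEDdef, prodBernoulli_real_subset (u ε) D]
    refine Finset.prod_pos fun e he => ?_
    simp only [hu, he, if_true, Set.Icc.coe_convexComb, Set.Icc.coe_one, mul_one]
    exact add_pos_of_nonneg_of_pos
      (mul_nonneg (unitInterval.one_minus_nonneg ε) (unitInterval.nonneg (w e))) hε
  -- the step at fixed `ε > 0`
  have hstep : ∀ ε : unitInterval, 0 < (ε : ℝ) →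
      (prodBernoulli g).real (openConn a b ∩ EC) ≤ (prodBernoulli g).real (openConn v b ∩ EC) +
        ((prodBernoulli (u ε)).real (openConn a b) - (prodBernoulli w).real (openConn a b)) := by
    intro ε hε
    have hma : (prodBernoulli w).real (openConn a b) ≤ (prodBernoulli (u ε)).real (openConn a b) :=
      prodBernoulli_real_mono_of_isUpperSet (hwu ε) (isUpperSet_openConn a b) MeasurableSet.of_discrete
    have hmv : (prodBernoulli w).real (openConn v b) ≤ (prodBernoulli (u ε)).real (openConn v b) :=
      prodBernoulli_real_mono_of_isUpperSet (hwu ε) (isUpperSet_openConn v b) MeasurableSet.of_discrete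
    have h3 := knLemma3i n (u ε) a v b Q
      ((prodBernoulli (u ε)).real (openConn a b) - (prodBernoulli w).real (openConn a b))
      hQmono (sub_nonneg.2 hma) (by linarith)
    rw [hcond ε (openConn a b), hcond ε (openConn v b), hcondQ ε] at h3
    have hEC1 : (prodBernoulli g).real EC ≤ 1 := measureReal_le_one
    have hd0 : 0 ≤ (prodBernoulli (u ε)).real (openConn a b) - (prodBernoulli w).real (openConn a b) :=
      sub_nonneg.2 hma
    have h4 : (prodBernoulli (u ε)).real ED * (prodBernoulli g).real (openConn a b ∩ EC) ≤
        (prodBernoulli (u ε)).real ED * ((prodBernoulli g).real (openConn v b ∩ EC) +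
          ((prodBernoulli (u ε)).real (openConn a b) - (prodBernoulli w).real (openConn a b))) := by
      have hED0 : 0 ≤ (prodBernoulli (u ε)).real ED := measureReal_nonneg
      nlinarith [h3, mul_le_mul_of_nonneg_left hEC1 (mul_nonneg hd0 hED0)]
    exact le_of_mul_le_mul_left h4 (hpos ε hε)
  -- `ε → 0`
  obtain ⟨ε, hεpos, hεlim⟩ := gluingLemma5_exists_seq_tendsto_zero
  have hF : Continuous fun t : unitInterval => (prodBernoulli (u t)).real (openConn a b) :=
    (stub_weightContinuity n (openConn a b)).comp hucont
  have hlim : Tendsto (fun k => (prodBernoulli g).real (openConn v b ∩ EC) +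
      ((prodBernoulli (u (ε k))).real (openConn a b) - (prodBernoulli w).real (openConn a b)))
      atTop (𝓝 ((prodBernoulli g).real (openConn v b ∩ EC) +
        ((prodBernoulli (u 0)).real (openConn a b) - (prodBernoulli w).real (openConn a b)))) :=
    tendsto_const_nhds.add (((hF.tendsto 0).comp hεlim).sub tendsto_const_nhds)
  rw [hu0, sub_self, add_zero] at hlim
  exact ge_of_tendsto' hlim fun k => hstep (ε k) (hεpos k)

/-- **Block form** of `upsetExchange_any`: on `{C open}` the anchor `v` is glued to the block, so the bound is by
`μ_{glue_S w}(s₀ ↔ b, C open)`. [cite: KozmaNitzan2024, Lemma 5 (p. 13)] -/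
theorem upsetExchange_any_block (w : Sym2 (Fin n) → unitInterval) (S : Finset (Fin n)) (a b v s₀ : Fin n)
    (hvS : v ∉ S) (hs₀ : s₀ ∈ S)
    (C : Finset (Sym2 (Fin n))) (hC : ∀ e ∈ C, ¬ e.IsDiag ∧ ∃ x ∈ e, x ∈ S) (hsv : s(s₀, v) ∈ C)
    (hyp : (prodBernoulli w).real (openConn a b) ≤ (prodBernoulli w).real (openConn v b)) :
    (prodBernoulli (fun e : Sym2 (Fin n) => if (∀ x ∈ e, x ∈ S) ∧ ¬ e.IsDiag then 1 else w e)).real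
        (openConn a b ∩ {ω | (↑C : Set (Sym2 (Fin n))) ⊆ ω}) ≤
      (prodBernoulli (fun e : Sym2 (Fin n) => if (∀ x ∈ e, x ∈ S) ∧ ¬ e.IsDiag then 1 else w e)).real
        (openConn s₀ b ∩ {ω | (↑C : Set (Sym2 (Fin n))) ⊆ ω}) := by
  refine (upsetExchange_any w S a b v s₀ hvS hs₀ C hC hsv hyp).trans (measureReal_mono ?_)
  rintro ω ⟨hvb, hCω⟩
  refine ⟨?_, hCω⟩
  have he : s(s₀, v) ∈ ω := hCω (Finset.mem_coe.2 hsv)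
  have hadj : (openGraph ω).Adj s₀ v := (openGraph_adj ω s₀ v).2 ⟨he, fun h => hvS (h ▸ hs₀)⟩
  exact hadj.reachable.trans hvb

end UpsetExchange

end

end Summit.CriticalPhenomena.PercolationContinuityZ3.Theorems
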